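import Literature.NumberTheory.EllipticCurves.Rank1Residual.X9ImageShape
import Literature.NumberTheory.GaloisRepresentations.DegreeOnePrimesFixedField
import HarnessLib

/-!
# BSD rank-≤1 residual cell — class X9: the exceptional prime SPLITS in the quadratic field `M`

HONEST FRAMING (cell `b2b-bsdres-*`, verbatim): the goal of the cell is to DELETE the
COMBINATION-SHAPED residual classes for ALL analytic-rank ≤ 1 curves over ℚ — "full BSD formula
for every rank ≤ 1 curve in class C" assembled STRICTLY from published theorems — so that the
rank-≤1 remainder becomes exactly the CONSTRUCTION-SHAPED classes, which are TYPED (missing-input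
Props), NOT attempted; this is not "finishing BSD".

Theorems only; sequel to `Rank1Residual/X9ImageShape.lean` (same seat).  There: at a good
ordinary `p ≥ 7` with `E[p]` irreducible and `ρ̄_{E,p}` not onto, the image
`G_p = Φ(ρ̄_{E,p}(Γ_ℚ))` normalises a split Cartan subgroup `C`, and the index-`2` subgroup
`U = ρ̄⁻¹(Φ⁻¹(C)) ≤ Γ_ℚ` (cutting out a quadratic field `M`, `ρ̄ ≅ Ind_M ψ̄`) contains every INERTIA
group above `p` — `M` is unramified at `p`.  Here: `U` contains the whole DECOMPOSITION group
(the stabiliser `𝔓.decompositionSubgroup Γ_ℚ` of a prime `𝔓 ∣ p` of `\bar ℤ`, tree `IntegralGaloisAction`), i.e. **`p` splits in `M`**, at every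
`p ≥ 5` and for every split Cartan subgroup normalised by the image:

* `mem_splitCartan_of_mem_normalizer_halfSplitCartan` — group theory (kept in this file's
  namespace): the normaliser of
  a split half-Cartan subgroup `P (1 0; 0 *) P⁻¹` (`|F| ≥ 3`) lies in the split Cartan subgroup
  `P (* 0; 0 *) P⁻¹` (an element normalising it preserves its two eigenlines and cannot swap them:
  `diag(u, 1) ∉ P⁻¹ H P` for `u ≠ 1`).
* `stabilizer_le_comap_splitCartan_of_goodOrd` — for `p ≥ 5` good ordinary, `E[p]` irreducible,
  `ρ̄_{E,p}` not onto, and ANY split Cartan subgroup `C = P (* 0; 0 *) P⁻¹` normalised by `G_p`: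
  the stabiliser of every prime `𝔓 ∣ p` of `\bar ℤ` lies in `U = ρ̄⁻¹(Φ⁻¹(C))`.  Proof: the image
  of the inertia group `I_𝔓` has order prime to `p` (Serre Prop. 15 under irr ∧ ¬surj), hence IS a
  split half-Cartan subgroup `H = P' (1 0; 0 *) P'⁻¹` (Serre §1.11, Cor. to Prop. 11); Prop. 14
  gives `C = P' (* 0; 0 *) P'⁻¹`; a decomposition element `σ` normalises `I_𝔓`, so `Φ(ρ̄ σ)`
  normalises `H`, hence lies in `C`.  In particular the arithmetic Frobenius at `𝔓` lies in `U`
  (`frob_mem_comap_splitCartan_of_goodOrd`, via Mathlib's `IsArithFrobAt.mem_stabilizer`).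
* Class forms `ClassX9.stabilizer_le_comap_splitCartan`, and for `p ≥ 7` the packaged statement
  `ClassX9.exists_index_two_subgroup_split`: `U` open of index `2` containing the decomposition
  groups above `p` and the inertia groups above every good prime — `ρ̄_{E,p} ≅ Ind_M^ℚ ψ̄` with
  `p` SPLIT in `M` (so, when `M` is imaginary, the Hida family of `ρ̄_{E,p}` contains CM forms
  `θ(ψ)`, ordinary at `p`: the situation of the cell's route-census row U1, EPW 2006 Cor. 1).

## References

* [Serre1972] J.-P. Serre, Invent. Math. 15 (1972): §1.11 Cor. to Prop. 11; §2.2 Prop. 14; §4.2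
  Lemme 2.
-/

noncomputable section

open scoped Classical NumberField MatrixGroups
open IsDedekindDomain Field Matrix
open WeierstrassCurve NumberField
open Literature.NumberTheory.GaloisRepresentations
  Literature.NumberTheory.GaloisRepresentations.Serre1972

/-! ### Group theory: the normaliser of a split half-Cartan subgroup -/

namespace Literature.NumberTheory.EllipticCurves.Rank1Residual

/-- **The normaliser of a split half-Cartan subgroup lies in its split Cartan subgroup.**  For a
field `F` with a unit `u ≠ 1` and `H = P (1 0; 0 *) P⁻¹ ≤ GL₂(F)`: if `g` normalises `H` then
`P⁻¹ g P` is diagonal, i.e. `g ∈ P (* 0; 0 *) P⁻¹`.  Proof: `x = P⁻¹ g P` conjugates `diag(1, u)`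
to a diagonal matrix `diag(1, u')`, so `x diag(1,u) = diag(1,u') x`; by
`GL2.isDg_or_isAd_of_mul_diagonal` `x` is diagonal or antidiagonal, and the `(0,1)` entry gives
`x₀₁ (u - 1) = 0`, excluding the antidiagonal case. (Serre 1972, n° 2.1–2.2: `C` is the unique
Cartan subgroup containing the half-Cartan `C'`; its normaliser permutes `D₁, D₂`.)
[cite: Serre1972, §2.1–2.2] -/
theorem mem_splitCartan_of_mem_normalizer_halfSplitCartan {F : Type*} [Field F]
    (hF : ∃ u : Fˣ, u ≠ 1) {P g : GL (Fin 2) F}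
    (hg : g ∈ Subgroup.normalizer (halfSplitCartan P : Set (GL (Fin 2) F))) :
    g ∈ splitCartan P := by
  obtain ⟨u, hu⟩ := hF
  have hh₀ : (MulAut.conj P).toMonoidHom (halfDiagonalHom u) ∈ halfSplitCartan P :=
    ⟨halfDiagonalHom u, by rw [← range_halfDiagonalHom]; exact ⟨u, rfl⟩, rfl⟩
  have hconj := (Subgroup.mem_normalizer_iff.mp hg _).mp hh₀
  rw [mem_halfSplitCartan_iff] at hconj
  have hrel : (P⁻¹ * (g * (MulAut.conj P).toMonoidHom (halfDiagonalHom u) * g⁻¹) * P :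
      GL (Fin 2) F) = (P⁻¹ * g * P) * halfDiagonalHom u * (P⁻¹ * g * P)⁻¹ := by
    rw [MulEquiv.coe_toMonoidHom, MulAut.conj_apply]; group
  rw [hrel] at hconj
  obtain ⟨hdg, h00⟩ := hconj
  set x : GL (Fin 2) F := P⁻¹ * g * P with hx
  obtain ⟨d', hd'⟩ : ∃ d' : Fin 2 → F,
      ((x * halfDiagonalHom u * x⁻¹ : GL (Fin 2) F) : Matrix (Fin 2) (Fin 2) F) = diagonal d' :=
    ⟨_, hdg.eq_diagonal⟩
  have hd'0 : d' 0 = 1 := by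
    rw [hd'] at h00
    simpa using h00
  have hxdet : (x : Matrix (Fin 2) (Fin 2) F).det ≠ 0 := GL2.det_ne_zero x
  have hmul :
      (x : Matrix (Fin 2) (Fin 2) F) * diagonal ![(1 : F), (u : F)] = diagonal d' * x := by
    have := congrArg (fun m : Matrix (Fin 2) (Fin 2) F ↦ m * x) hd'
    simpa only [Units.val_mul, Matrix.coe_units_inv, coe_halfDiagonalHom, Matrix.mul_assoc,
      Matrix.nonsing_inv_mul _ hxdet.isUnit, Matrix.mul_one] using this
  have hne : (![(1 : F), (u : F)] : Fin 2 → F) 0 ≠ (![(1 : F), (u : F)] : Fin 2 → F) 1 := by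
    intro h
    apply hu
    exact Units.ext (by simpa using h.symm)
  rw [mem_splitCartan_iff]
  rcases GL2.isDg_or_isAd_of_mul_diagonal hxdet hne hmul with h | h
  · exact h
  · exfalso
    have hu1 : (u : F) ≠ 1 := fun h1 ↦ hu (Units.ext h1)
    -- the `(0,1)` entry of `x diag(1,u) = diag(d') x`: `x₀₁ u = d'₀ x₀₁ = x₀₁`
    have e := congrFun (congrFun hmul 0) 1
    simp only [Matrix.mul_diagonal, Matrix.diagonal_mul, hd'0, one_mul, Matrix.cons_val_one,
      Matrix.cons_val_fin_one] at e
    have h01 : (x : Matrix (Fin 2) (Fin 2) F) 0 1 = 0 := by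
      have h2 : (x : Matrix (Fin 2) (Fin 2) F) 0 1 * ((u : F) - 1) = 0 := by
        rw [mul_sub, mul_one, sub_eq_zero]; exact e
      rcases mul_eq_zero.mp h2 with h0 | h0
      · exact h0
      · exact absurd (sub_eq_zero.mp h0) hu1
    apply hxdet
    rw [Matrix.det_fin_two, h.1, h01]
    ring

/-! ### The decomposition group at `p` lies in `U` -/

variable (W : WeierstrassCurve ℚ) [W.IsElliptic] [W.IsGloballyMinimal] (p : ℕ) [Fact p.Prime]
  (Φ : Multiplicative (AddAut (geomTorsion W p)) ≃* GL (Fin 2) (ZMod p))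
  (e : geomTorsion W p ≃+ (Fin 2 → ZMod p))
  (he : ∀ (g : Multiplicative (AddAut (geomTorsion W p))) (x : geomTorsion W p),
    e (Multiplicative.toAdd g x) =
      ((Φ g : GL (Fin 2) (ZMod p)) : Matrix (Fin 2) (Fin 2) (ZMod p)) *ᵥ e x)

include he

/-- **The stabiliser of a prime above `p` lies in `U = ρ̄⁻¹(Φ⁻¹(C))`** for every split Cartan
subgroup `C = P (* 0; 0 *) P⁻¹` normalised by the image, at a prime `p ≥ 5` of good ordinary
reduction with `E[p]` irreducible and `ρ̄_{E,p}` not onto.  (The stabiliser of `𝔓` in `Γ_ℚ` is the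
decomposition group `D_𝔓`; so the quadratic field `M` of `U` is SPLIT at `p`.)  Proof: `Φ(ρ̄(I_𝔓))`
has order prime to `p` (Prop. 15: otherwise the image is Borel or `GL₂`), so by Serre §1.11 Cor.
to Prop. 11 it IS a split half-Cartan subgroup `H = P' (1 0; 0 *) P'⁻¹`
(`eq_halfSplitCartan_map_of_not_dvd_card`); `H ≤ G_p ≤ N(C)` forces `C = P' (* 0; 0 *) P'⁻¹`
(Prop. 14); `σ ∈ D_𝔓` normalises `I_𝔓` (inertia groups of conjugate primes are conjugate), so
`Φ(ρ̄ σ)` normalises `H` and lies in `C` (`mem_splitCartan_of_mem_normalizer_halfSplitCartan`).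
[cite: Serre1972, §1.11 Cor. to Prop. 11; §2.2 Prop. 14] -/
theorem stabilizer_le_comap_splitCartan_of_goodOrd (h5 : 5 ≤ p) (hord : GoodOrd W p)
    (hirr : Irr W p) (hns : ¬ Surj W p) {P : GL (Fin 2) (ZMod p)}
    (hGN : (galoisRepTorsion W p).range.map Φ.toMonoidHom ≤
      Subgroup.normalizer (splitCartan P : Set (GL (Fin 2) (ZMod p))))
    {v : HeightOneSpectrum (𝓞 ℚ)} (hv : (Rat.HeightOneSpectrum.primesEquiv v : ℕ) = p)
    {𝔓 : Ideal (absIntegers (𝓞 ℚ) ℚ)} (h𝔓 : 𝔓 ∈ v.primesAbove) :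
    𝔓.decompositionSubgroup (absoluteGaloisGroup ℚ) ≤
      ((splitCartan P).comap Φ.toMonoidHom).comap (galoisRepTorsion W p) := by
  letI : Module (ZMod p) (geomTorsion W p) := AddSubgroup.torsionBy.zmodModule
  have hpP : p.Prime := Fact.out
  have hp2 : p ≠ 2 := by omega
  set ρ := galoisRepTorsion W p with hρ
  set G : Subgroup (GL (Fin 2) (ZMod p)) := ρ.range.map Φ.toMonoidHom with hG
  -- `p ∤ #G`
  have hpG : ¬ p ∣ Nat.card G := by
    intro hdvd
    rcases eq_top_or_borel_of_dvd_card G hdvd (exists_mem_map_range_det_eq W p Φ e he) with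
      h | ⟨w, hw, hB⟩
    · exact hns ((map_range_galoisRepTorsion_eq_top_iff W p Φ).mp h)
    · exact not_le_eigenvectorStabilizer_of_hasIrreducibleModPGaloisRep W p Φ e he hirr hw hB
  -- the image of inertia at `𝔓` is a split half-Cartan subgroup `halfSplitCartan P'`
  have hHle : ((𝔓.inertia (absoluteGaloisGroup ℚ)).map ρ).map Φ.toMonoidHom ≤ G :=
    Subgroup.map_mono (fun x ⟨τ, _, hτ⟩ ↦ ⟨τ, hτ⟩)
  have hpH : ¬ p ∣ Nat.card (((𝔓.inertia (absoluteGaloisGroup ℚ)).map ρ).map Φ.toMonoidHom) :=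
    fun h ↦ hpG (h.trans (Subgroup.card_dvd_of_le hHle))
  have hΔ := W.not_dvd_minimalDiscriminantInt_of_hasGoodReductionAtPrime' p hord.1
  obtain ⟨v₀, hv₀, hquot⟩ :=
    exists_line_of_not_dvd_frobeniusTrace_of_mem_primesAbove p hΔ hord.2 hv h𝔓
  obtain ⟨P', -, hP'⟩ := eq_halfSplitCartan_map_of_not_dvd_card e Φ he
    (I := (𝔓.inertia (absoluteGaloisGroup ℚ)).map ρ) hv₀
    (fun τ' ⟨τ, hτ, hτ'⟩ x ↦ by subst hτ'; exact hquot τ hτ x)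
    (fun a ↦ by
      obtain ⟨τ, hτ, hτv⟩ := W.exists_mem_inertia_smul_eq_of_sub_mem_line p hv h𝔓 hv₀ hquot a
      exact ⟨ρ τ, ⟨τ, hτ, rfl⟩, hτv⟩) hpH
  -- Prop. 14: `C` is the split Cartan subgroup of `P'`
  have hCC : splitCartan P = splitCartan P' :=
    eq_splitCartan_of_halfSplitCartan_le_normalizer (splitCartan_mem_cartanSubgroups P) h5
      (by rw [← hP']; exact hHle.trans hGN)
  intro σ hσ
  have hσ𝔓 := (Ideal.mem_decompositionSubgroup_iff).mp hσ
  have hσ𝔓' := (Ideal.mem_decompositionSubgroup_iff).mp (inv_mem hσ)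
  show Φ.toMonoidHom (ρ σ) ∈ splitCartan P
  rw [hCC]
  refine mem_splitCartan_of_mem_normalizer_halfSplitCartan (exists_units_ne_one hp2) ?_
  rw [← hP', Subgroup.mem_normalizer_iff]
  intro y
  constructor
  · rintro ⟨x, ⟨τ, hτ, rfl⟩, rfl⟩
    have hτ' : σ * τ * σ⁻¹ ∈ 𝔓.inertia (absoluteGaloisGroup ℚ) := by
      have h1 := DegreeOnePrimes.conj_mem_inertia_of_mem_inertia_smul
        (G := absoluteGaloisGroup ℚ) (g := σ⁻¹) (Q := 𝔓) (τ := τ) (by rw [hσ𝔓']; exact hτ)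
      simpa only [inv_inv] using h1
    refine ⟨ρ (σ * τ * σ⁻¹), ⟨σ * τ * σ⁻¹, hτ', rfl⟩, ?_⟩
    simp only [MulEquiv.coe_toMonoidHom, map_mul, map_inv]
  · rintro ⟨x, ⟨τ, hτ, rfl⟩, hx⟩
    have hτ' : σ⁻¹ * τ * σ ∈ 𝔓.inertia (absoluteGaloisGroup ℚ) :=
      DegreeOnePrimes.conj_mem_inertia_of_mem_inertia_smul
        (G := absoluteGaloisGroup ℚ) (g := σ) (Q := 𝔓) (τ := τ) (by rw [hσ𝔓]; exact hτ)
    refine ⟨ρ (σ⁻¹ * τ * σ), ⟨σ⁻¹ * τ * σ, hτ', rfl⟩, ?_⟩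
    simp only [MulEquiv.coe_toMonoidHom, map_mul, map_inv] at hx ⊢
    rw [hx]
    group

/-- **The arithmetic Frobenius at `𝔓 ∣ p` lies in `U`** ("`p` splits in `M`"): under the
hypotheses of `stabilizer_le_comap_splitCartan_of_goodOrd`, every `σ ∈ Γ_ℚ` which is an arithmetic
Frobenius at `𝔓` (Mathlib `IsArithFrobAt`) satisfies `Φ(ρ̄ σ) ∈ C`, since such a `σ` stabilises
`𝔓` (`IsArithFrobAt.mem_stabilizer`). [cite: Serre1972, §2.2 Prop. 14] -/
theorem frob_mem_comap_splitCartan_of_goodOrd (h5 : 5 ≤ p) (hord : GoodOrd W p)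
    (hirr : Irr W p) (hns : ¬ Surj W p) {P : GL (Fin 2) (ZMod p)}
    (hGN : (galoisRepTorsion W p).range.map Φ.toMonoidHom ≤
      Subgroup.normalizer (splitCartan P : Set (GL (Fin 2) (ZMod p))))
    {v : HeightOneSpectrum (𝓞 ℚ)} (hv : (Rat.HeightOneSpectrum.primesEquiv v : ℕ) = p)
    {𝔓 : Ideal (absIntegers (𝓞 ℚ) ℚ)} (h𝔓 : 𝔓 ∈ v.primesAbove)
    {σ : absoluteGaloisGroup ℚ} (hσ : IsArithFrobAt (𝓞 ℚ) σ 𝔓) :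
    σ ∈ ((splitCartan P).comap Φ.toMonoidHom).comap (galoisRepTorsion W p) := by
  haveI : 𝔓.IsPrime := h𝔓.1
  have hmem : σ ∈ 𝔓.decompositionSubgroup (absoluteGaloisGroup ℚ) := hσ.mem_stabilizer
  exact stabilizer_le_comap_splitCartan_of_goodOrd W p Φ e he h5 hord hirr hns hGN hv h𝔓 hmem

/-- **X9 ⟹ the decomposition groups above `p` lie in `U`** for every split Cartan subgroup
normalised by the image (class form of `stabilizer_le_comap_splitCartan_of_goodOrd`; applies at
`p = 5` to the `5Ns`-type pairs and at `p = 7` to all pairs). [folklore] -/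
theorem ClassX9.stabilizer_le_comap_splitCartan (h : ClassX9 W p) {P : GL (Fin 2) (ZMod p)}
    (hGN : (galoisRepTorsion W p).range.map Φ.toMonoidHom ≤
      Subgroup.normalizer (splitCartan P : Set (GL (Fin 2) (ZMod p))))
    {v : HeightOneSpectrum (𝓞 ℚ)} (hv : (Rat.HeightOneSpectrum.primesEquiv v : ℕ) = p)
    {𝔓 : Ideal (absIntegers (𝓞 ℚ) ℚ)} (h𝔓 : 𝔓 ∈ v.primesAbove) :
    𝔓.decompositionSubgroup (absoluteGaloisGroup ℚ) ≤
      ((splitCartan P).comap Φ.toMonoidHom).comap (galoisRepTorsion W p) :=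
  stabilizer_le_comap_splitCartan_of_goodOrd W p Φ e he h.2.2.1 h.2.1 h.2.2.2.1 h.2.2.2.2.1 hGN hv
    h𝔓

/-- **X9 at `p ≥ 7`: `ρ̄_{E,p}` is induced from a quadratic field `M` in which `p` SPLITS and
which is unramified at every good prime.**  Packaged form: there is a split Cartan subgroup
`C = P (* 0; 0 *) P⁻¹` with `G_p ≤ N(C)`, `G_p ⊄ C`, and `U = ρ̄⁻¹(Φ⁻¹(C))` is open of index `2`,
contains the stabiliser (decomposition group) of every prime of `\bar ℤ` above `p`, and the
inertia group of every prime above a good prime `q` (for `q = p` this is inside the stabiliser).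
[folklore] -/
theorem ClassX9.exists_index_two_subgroup_split (h : ClassX9 W p) (h7 : 7 ≤ p) :
    ∃ (P : GL (Fin 2) (ZMod p)),
      (galoisRepTorsion W p).range.map Φ.toMonoidHom ≤
          Subgroup.normalizer (splitCartan P : Set (GL (Fin 2) (ZMod p))) ∧
      ¬ (galoisRepTorsion W p).range.map Φ.toMonoidHom ≤ splitCartan P ∧
      IsOpen ((((splitCartan P).comap Φ.toMonoidHom).comap (galoisRepTorsion W p) :
          Subgroup (absoluteGaloisGroup ℚ)) : Set (absoluteGaloisGroup ℚ)) ∧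
      (((splitCartan P).comap Φ.toMonoidHom).comap (galoisRepTorsion W p)).index = 2 ∧
      (∀ v : HeightOneSpectrum (𝓞 ℚ), (Rat.HeightOneSpectrum.primesEquiv v : ℕ) = p →
        ∀ 𝔓 ∈ v.primesAbove, 𝔓.decompositionSubgroup (absoluteGaloisGroup ℚ) ≤
          ((splitCartan P).comap Φ.toMonoidHom).comap (galoisRepTorsion W p)) ∧
      (∀ (q : ℕ) [Fact q.Prime], W.HasGoodReductionAtPrime q →
        ∀ v : HeightOneSpectrum (𝓞 ℚ), (Rat.HeightOneSpectrum.primesEquiv v : ℕ) = q →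
        ∀ 𝔔 ∈ v.primesAbove,
          𝔔.inertia (absoluteGaloisGroup ℚ) ≤
            ((splitCartan P).comap Φ.toMonoidHom).comap (galoisRepTorsion W p)) := by
  obtain ⟨P, hGN, hGC, hopen, hidx, hin⟩ := ClassX9.exists_index_two_subgroup W p Φ e he h h7
  exact ⟨P, hGN, hGC, hopen, hidx,
    fun v hv 𝔓 h𝔓 ↦ ClassX9.stabilizer_le_comap_splitCartan W p Φ e he h hGN hv h𝔓, hin⟩

end Literature.NumberTheory.EllipticCurves.Rank1Residual

end
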